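import Summits.Ventures.Crystal3D.Theorems.StickyWulffConstantPolycrystalWulffBoundFreeEnergyExterior

/-!
# `PolycrystalWulffBound`: the INTERSECTION-BODY bound for the free energy of a polyhedral texture
# (line `PolyDensity`, crux `stmt-Ventures-19482`)

Route `StickyWulffConstant` of the venture `Summits/Ventures/Crystal3D`, second prover lane (poly-p2,
gen 3).  Two general facts about the free (exterior) energy
`Fr = Σ_f [per K_f (G f) − Σ_{g ≠ f} ι_{K_f}(G f, G g)]` of pairwise disjoint polyhedral grains with
origin-symmetric compact convex bodies `K_f ∋ 0`:

* `per_iUnion_le_freeEnergy` — if a symmetric body `K ∋ 0` lies in every `K_f`, then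
  `per K (⋃ f, G f) ≤ Fr` (every free facet is charged `h_{K_f}(ν) ≥ h_K(ν)`, walls are not charged);
* `wulff_le_per` — the anisotropic isoperimetric (Wulff) inequality for the route's real-valued
  `per`: `3 |K|^{1/3} |G|^{2/3} ≤ per K G` for every compact convex `K ∋ 0` and every `G` of finite
  perimeter and finite volume (tree theorem `anisotropic_isoperimetric_inequality`).

Together: `Fr ≥ 3 |⋂_f K_f|^{1/3} |⋃_f G_f|^{2/3}` — the only structure-free lower bound that sees the
MISORIENTATION of the grains (for the crux's Wulff bodies, `|W(A_f) ∩ W(A_g)| < 32` unless the two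
lattices coincide).  Used by the two-class twin-free rung.
WHAT THIS IS NOT: a statement about walls; F-C1 not moved.
-/

noncomputable section

namespace Summit.Ventures.Crystal3D.Theorems

open MeasureTheory Set Metric
open scoped RealInnerProductSpace ENNReal Pointwise
open Summit.Ventures.Crystal3D.Cruxes.TextureLiminf.TexShadow
open Literature.Analysis.Convexity
open Literature.MathematicalPhysics.StatisticalMechanics (perimeter HasFinitePerimeter)

/-- **The free energy dominates the `K`-perimeter of the union for every common sub-body `K`.**
For pairwise disjoint polyhedral grains of finite volume, origin-symmetric compact convex bodies
`K_f ∋ 0`, and an origin-symmetric compact convex `K ∋ 0` with `K ⊆ K_f` for all `f`: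
`per K (⋃ f, G f) ≤ Σ_f [per K_f (G f) − Σ_g (if f = g then 0 else ι_{K_f}(G f, G g))]`. -/
theorem per_iUnion_le_freeEnergy {n : ℕ} (G : Fin n → Set E3)
    (hPoly : ∀ f, ∃ (k : ℕ) (H : Fin k → Finset (E3 × ℝ)), G f = ⋃ i, polytope (H i))
    (hvol : ∀ f, volume (G f) < ⊤) (hdisjG : ∀ f g, f ≠ g → Disjoint (G f) (G g))
    (Kf : Fin n → Set E3) (hKc : ∀ f, IsCompact (Kf f)) (hKv : ∀ f, Convex ℝ (Kf f))
    (hK0 : ∀ f, (0 : E3) ∈ Kf f) (hKs : ∀ f, -Kf f = Kf f)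
    {K : Set E3} (hKc' : IsCompact K) (hKv' : Convex ℝ K) (hK0' : (0 : E3) ∈ K) (hKs' : -K = K)
    (hsub : ∀ f, K ⊆ Kf f) :
    per K (⋃ f, G f) ≤
      ∑ f, (per (Kf f) (G f) - ∑ g, (if f = g then 0 else
        (per (Kf f) (G f) + per (Kf f) (G g) - per (Kf f) (G f ∪ G g)) / 2)) := by
  obtain ⟨k, H, ν, S, SX, -, hext, htot⟩ := exists_exterior_crossSums G hPoly hvol hdisjG
  -- the cross kernel, abbreviated
  set X : Set E3 → Fin k → Fin k → ℝ := fun K a b =>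
    (if a < b then (supportFn K (ν a b) + supportFn K (-ν a b)) *
        facetArea (closure (polytope (H a)) ∩ closure (polytope (H b))) (ν a b)
      else (supportFn K (ν b a) + supportFn K (-ν b a)) *
        facetArea (closure (polytope (H b)) ∩ closure (polytope (H a))) (ν b a)) with hX
  -- each grain: free energy = half the cross sum with the exterior cells
  have hf : ∀ f, per (Kf f) (G f) - ∑ g, (if f = g then 0 else
      (per (Kf f) (G f) + per (Kf f) (G g) - per (Kf f) (G f ∪ G g)) / 2) =
      (∑ a ∈ S f, ∑ b ∈ SX, X (Kf f) a b) / 2 := by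
    intro f
    have h : 2 * per (Kf f) (G f) = (∑ g ∈ Finset.univ.erase f,
        (per (Kf f) (G f) + per (Kf f) (G g) - per (Kf f) (G f ∪ G g))) +
        ∑ a ∈ S f, ∑ b ∈ SX, X (Kf f) a b := hext (Kf f) (hKc f) (hKv f) (hK0 f) (hKs f) f
    rw [sum_ite_eq_sum_erase_div_two]
    linarith
  -- monotonicity of the cross sums in the body
  have hmono : ∀ f, (∑ a ∈ S f, ∑ b ∈ SX, X K a b) ≤ ∑ a ∈ S f, ∑ b ∈ SX, X (Kf f) a b :=
    fun f => crossSum_mono (hsub f) (hKc f).isBounded ⟨0, hK0'⟩ H ν (S f) SX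
  -- the `K` cross sums add up to `2 per K E`
  have ht : 2 * per K (⋃ f, G f) = ∑ f, ∑ a ∈ S f, ∑ b ∈ SX, X K a b := htot K hKc' hKv' hK0' hKs'
  calc per K (⋃ f, G f) = ∑ f, (∑ a ∈ S f, ∑ b ∈ SX, X K a b) / 2 := by
        rw [← Finset.sum_div]; linarith
    _ ≤ ∑ f, (∑ a ∈ S f, ∑ b ∈ SX, X (Kf f) a b) / 2 :=
        Finset.sum_le_sum fun f _ => div_le_div_of_nonneg_right (hmono f) zero_le_two
    _ = _ := Finset.sum_congr rfl fun f _ => (hf f).symm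

/-- **The Wulff inequality for the route's real-valued `per`.**  For a compact convex `K ∋ 0` and a
set `G` of finite perimeter and finite volume: `3 · |K|^{1/3} · |G|^{2/3} ≤ per K G`
(`anisotropic_isoperimetric_inequality` with `n = 3`; the `K`-perimeter of `G` is finite because `K`
is bounded). -/
theorem wulff_le_per {K : Set E3} (hK : IsCompact K) (hKc : Convex ℝ K) (h0K : (0 : E3) ∈ K)
    {G : Set E3} (hG : HasFinitePerimeter G) (hvol : volume G < ⊤) :
    3 * (volume K).toReal ^ ((1 : ℝ) / 3) * (volume G).toReal ^ ((2 : ℝ) / 3) ≤ per K G := by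
  -- `K` lies in a ball
  obtain ⟨R, hR0, hR⟩ : ∃ R : ℝ, 0 < R ∧ K ⊆ closedBall (0 : E3) R := by
    obtain ⟨R, hR⟩ := hK.isBounded.subset_closedBall (0 : E3)
    exact ⟨max R 1, by positivity, hR.trans (closedBall_subset_closedBall (le_max_left _ _))⟩
  -- finiteness of the `K`-perimeter
  have hPfin : perK K G < ⊤ := by
    rw [perK_eq_anisotropicPerimeter]
    exact (anisotropicPerimeter_le_mul_perimeter hR0 hR G).trans_lt
      (ENNReal.mul_lt_top ENNReal.ofReal_lt_top hG.2)
  -- the isoperimetric inequality with `n = 3`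
  have hmain := anisotropic_isoperimetric_inequality (n := 3) (by norm_num) hK hKc h0K hG.1 hvol
  set VK : ℝ := (volume K).toReal with hVK
  set V : ℝ := (volume G).toReal with hV
  have hVK0 : 0 ≤ VK := ENNReal.toReal_nonneg
  have hV0 : 0 ≤ V := ENNReal.toReal_nonneg
  have hvolK : volume K = ENNReal.ofReal VK := (ENNReal.ofReal_toReal hK.measure_lt_top.ne).symm
  have hvolV : volume G = ENNReal.ofReal V := (ENNReal.ofReal_toReal hvol.ne).symm
  have hlow : (3 : ℝ≥0∞) * ENNReal.ofReal VK ^ ((3 : ℝ)⁻¹) * (ENNReal.ofReal V ^ ((3 : ℝ)⁻¹)) ^ 2 ≤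
      perK K G := by
    refine le_trans (le_of_eq ?_) hmain
    rw [hvolK, hvolV]
    simp only [Nat.cast_ofNat, show (3 : ℕ) - 1 = 2 from rfl]
  have hlow' : ENNReal.ofReal (3 * VK ^ ((3 : ℝ)⁻¹) * (V ^ ((3 : ℝ)⁻¹)) ^ 2) ≤
      ENNReal.ofReal (per K G) := by
    unfold per
    rw [ENNReal.ofReal_toReal hPfin.ne]
    refine le_trans (le_of_eq ?_) hlow
    rw [ENNReal.ofReal_mul (by positivity), ENNReal.ofReal_mul (by positivity),
      ENNReal.ofReal_pow (by positivity), ENNReal.ofReal_rpow_of_nonneg hVK0 (by positivity),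
      ENNReal.ofReal_rpow_of_nonneg hV0 (by positivity), ENNReal.ofReal_ofNat]
  have hper0 : 0 ≤ per K G := ENNReal.toReal_nonneg
  have hreal : 3 * VK ^ ((3 : ℝ)⁻¹) * (V ^ ((3 : ℝ)⁻¹)) ^ 2 ≤ per K G :=
    (ENNReal.ofReal_le_ofReal_iff hper0).1 hlow'
  have h13 : ((3 : ℝ)⁻¹) = (1 : ℝ) / 3 := by norm_num
  have h23 : (V ^ ((3 : ℝ)⁻¹)) ^ 2 = V ^ ((2 : ℝ) / 3) := by
    rw [← Real.rpow_mul_natCast hV0]; norm_num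
  rwa [h23, h13] at hreal

/-- **The intersection-body bound.**  For pairwise disjoint polyhedral grains of finite perimeter and
finite volume with origin-symmetric compact convex bodies `K_f ∋ 0`, and an origin-symmetric compact
convex `K ∋ 0` contained in every `K_f`:
`3 · |K|^{1/3} · |⋃ f, G f|^{2/3} ≤ Fr` (the free energy with the bodies `K_f`). -/
theorem wulff_inter_le_freeEnergy {n : ℕ} (G : Fin n → Set E3)
    (hfin : ∀ f, HasFinitePerimeter (G f) ∧ volume (G f) < ⊤)
    (hPoly : ∀ f, ∃ (k : ℕ) (H : Fin k → Finset (E3 × ℝ)), G f = ⋃ i, polytope (H i))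
    (hdisjG : ∀ f g, f ≠ g → Disjoint (G f) (G g))
    (Kf : Fin n → Set E3) (hKc : ∀ f, IsCompact (Kf f)) (hKv : ∀ f, Convex ℝ (Kf f))
    (hK0 : ∀ f, (0 : E3) ∈ Kf f) (hKs : ∀ f, -Kf f = Kf f)
    {K : Set E3} (hKc' : IsCompact K) (hKv' : Convex ℝ K) (hK0' : (0 : E3) ∈ K) (hKs' : -K = K)
    (hsub : ∀ f, K ⊆ Kf f) :
    3 * (volume K).toReal ^ ((1 : ℝ) / 3) * (volume (⋃ f, G f)).toReal ^ ((2 : ℝ) / 3) ≤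
      ∑ f, (per (Kf f) (G f) - ∑ g, (if f = g then 0 else
        (per (Kf f) (G f) + per (Kf f) (G g) - per (Kf f) (G f ∪ G g)) / 2)) := by
  obtain ⟨hEm, hEv, hEp, -⟩ := texture_union_facts G hfin hdisjG
  exact (wulff_le_per hKc' hKv' hK0' ⟨hEm, lt_top_iff_ne_top.2 hEp⟩ hEv).trans
    (per_iUnion_le_freeEnergy G hPoly (fun f => (hfin f).2) hdisjG Kf hKc hKv hK0 hKs hKc' hKv'
      hK0' hKs' hsub)

/-- **The free energy is monotone in the bodies.**  For pairwise disjoint polyhedral grains of finite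
volume and two families of origin-symmetric compact convex bodies `K'_f ⊆ K_f ∋ 0`:
`Fr(K') ≤ Fr(K)` (every free facet of grain `f` is charged `h_{K'_f}(ν) ≤ h_{K_f}(ν)`; walls are not
charged by either).  With `K'_f` constant on blocks of grains this feeds the block (merged-class)
second pincer. -/
theorem freeEnergy_mono {n : ℕ} (G : Fin n → Set E3)
    (hPoly : ∀ f, ∃ (k : ℕ) (H : Fin k → Finset (E3 × ℝ)), G f = ⋃ i, polytope (H i))
    (hvol : ∀ f, volume (G f) < ⊤) (hdisjG : ∀ f g, f ≠ g → Disjoint (G f) (G g))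
    (Kf : Fin n → Set E3) (hKc : ∀ f, IsCompact (Kf f)) (hKv : ∀ f, Convex ℝ (Kf f))
    (hK0 : ∀ f, (0 : E3) ∈ Kf f) (hKs : ∀ f, -Kf f = Kf f)
    (Kf' : Fin n → Set E3) (hKc' : ∀ f, IsCompact (Kf' f)) (hKv' : ∀ f, Convex ℝ (Kf' f))
    (hK0' : ∀ f, (0 : E3) ∈ Kf' f) (hKs' : ∀ f, -Kf' f = Kf' f) (hsub : ∀ f, Kf' f ⊆ Kf f) :
    (∑ f, (per (Kf' f) (G f) - ∑ g, (if f = g then 0 else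
        (per (Kf' f) (G f) + per (Kf' f) (G g) - per (Kf' f) (G f ∪ G g)) / 2))) ≤
      ∑ f, (per (Kf f) (G f) - ∑ g, (if f = g then 0 else
        (per (Kf f) (G f) + per (Kf f) (G g) - per (Kf f) (G f ∪ G g)) / 2)) := by
  obtain ⟨k, H, ν, S, SX, -, hext, -⟩ := exists_exterior_crossSums G hPoly hvol hdisjG
  set X : Set E3 → Fin k → Fin k → ℝ := fun K a b =>
    (if a < b then (supportFn K (ν a b) + supportFn K (-ν a b)) *
        facetArea (closure (polytope (H a)) ∩ closure (polytope (H b))) (ν a b)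
      else (supportFn K (ν b a) + supportFn K (-ν b a)) *
        facetArea (closure (polytope (H b)) ∩ closure (polytope (H a))) (ν b a)) with hX
  -- each grain: free energy = half the cross sum with the exterior cells, for either family
  have hf : ∀ (K : Set E3), IsCompact K → Convex ℝ K → (0 : E3) ∈ K → -K = K → ∀ f,
      per K (G f) - ∑ g, (if f = g then 0 else
        (per K (G f) + per K (G g) - per K (G f ∪ G g)) / 2) =
      (∑ a ∈ S f, ∑ b ∈ SX, X K a b) / 2 := by
    intro K hK hKv0 hK00 hKs0 f
    have h : 2 * per K (G f) = (∑ g ∈ Finset.univ.erase f,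
        (per K (G f) + per K (G g) - per K (G f ∪ G g))) +
        ∑ a ∈ S f, ∑ b ∈ SX, X K a b := hext K hK hKv0 hK00 hKs0 f
    rw [sum_ite_eq_sum_erase_div_two]
    linarith
  refine Finset.sum_le_sum fun f _ => ?_
  rw [hf (Kf' f) (hKc' f) (hKv' f) (hK0' f) (hKs' f) f, hf (Kf f) (hKc f) (hKv f) (hK0 f) (hKs f) f]
  exact div_le_div_of_nonneg_right
    (crossSum_mono (hsub f) (hKc f).isBounded ⟨0, hK0' f⟩ H ν (S f) SX) zero_le_two

end Summit.Ventures.Crystal3D.Theorems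

end
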